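import Literature.AnabelianGeometry.EtaleTheta.Discharge.Sec1Thm110DeltaInducedUnique
import Literature.AnabelianGeometry.EtaleTheta.Discharge.Sec1Prop18InstanceForms
import HarnessLib

/-!
# [EtTh] Thm. 1.10 (ii) as a SCHEMA over the §1 interface: the exact criterion for the typed `Thm110ii`
# (FROZEN FACT-LIST row F-0514) and the refutation shape of its universal closure (proof-only)

S. Mochizuki, *The étale theta function and its Frobenioid-theoretic manifestations*, Publ. RIMS **45**
(2009), §1, Def. 1.9 (i) p. 29 and Thm. 1.10 (ii) pp. 29–30 (printed 255–256)
[cite: MochizukiEtTh2009, Thm 1.10 (ii) p.30]: «The isomorphism `K^×_α →̃ K^×_β` … induced by `γ` preserves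
the standard sets of values of `η̈^{Θ,Z}_☐`.» abc-iut cell, block F (fact-proving wave), seat abc-iut-f-114
(gen 3), tranche 114 — the successor item of this seat's gen-0 HANDOFF («F-0514: instance forms landed
(`Sec1Prop18InstanceForms`, p428778); general `γ` needs abc-iut-w5-d140's sub-DAG inputs»), the MODEL-FREE
half; sibling of abc-iut-f-113's `Sec1Thm110iUniqueSchemaCriterion.lean` (p433898, rows F-0512/F-0513).
PROOF-ONLY companion (no `def`, no instance, no new named fact) of abc-iut-L2-t1's
`ConstantMultipleRigidity.lean` (`Thm110ii`, `Thm110Hypothesis`, `MuTwoSetting.valuesAt`,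
`IsStandardSetOfValues`, `StandardData`), abc-iut-w5-d140's `ConstantMultipleRigiditySub.lean`
(`Thm110DeltaInduced`, `Thm110ValuesForward`, `thm110ii_of_valuesForward`) and
`Discharge/Sec1Thm110DeltaInducedUnique.lean` (`Thm110DeltaInduced.unique`), and this seat's
`Discharge/Sec1Prop18InstanceForms.lean` (`exists_thm110Hypothesis_γX_eq_refl`) — all consumed BY NAME,
nothing restated.

WHY. F-0514 is a PARAMETRISED schema (R5) on abstract `MuTwoSetting`s whose Def. 1.9 data
`S : StandardData` — the points `τ`, `τ⁻¹` with their evaluation maps — are FREE (`NonCuspidalPoint.evalAt`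
is pinned only on the Kummer classes of constants). The tree holds SUFFICIENT routes to `Thm110ii`
(`thm110ii_of_decompTransport`, `thm110ii_of_matching`, `thm110ii_of_decompTransport_of_deck`, and the
identity instance `thm110ii_of_transport_eq_self`); a non-vacuous TEST of the ∀-closure waits for a
Kummer-carrying `MuTwoSetting` (the R78 cluster's construction; the root model carries no `EtaleThetaData`,
`SettingModel.thm110i_rootModel`). THIS FILE settles the model-free part — WHAT EXACTLY the ∀-closure asks
of the free data. Write `V(y) := valuesAt hC εZ η̈ y ⊆ K̈^×` (Def. 1.9 (i)). RESULTS: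
* **`thm110ii_iff_valuesForward`** — «THE isomorphism induced by `γ`» is unique
  (`Thm110DeltaInduced.unique`), so for ANY induced `δ₀`: `Thm110ii H Sα Sβ ⟺ Thm110ValuesForward H Sα Sβ δ₀`
  ⟺ `δ₀(V(τα)) ∈ {V(τβ), V(τβ⁻¹)} ∧ δ₀(V(τα⁻¹)) ∈ {V(τβ), V(τβ⁻¹)}` (`thm110ii_iff_image_valuesAt`); the
  refutation shape `not_thm110ii_of_deltaInduced`;
* **`thm110ii_iff_isStandardSetOfValues_of_transport_eq_self`** — over ONE setting and ONE étale theta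
  datum, for every hypothesis structure with identity cohomology transport (e.g. `γ_X = id`,
  `transport_eq_self_of_γX_eq_refl`): the induced `δ` is the identity and
  `Thm110ii H Sα Sβ ⟺` «every standard set of values of `Sα` is a standard set of values of `Sβ`»
  ⟺ `V(τα), V(τα⁻¹) ∈ {V(τβ), V(τβ⁻¹)}` (`thm110ii_iff_valuesAt_of_transport_eq_self`); refutation shape
  `not_thm110ii_of_transport_eq_self` / `…_of_γX_eq_refl`;
* `MuTwoSetting.StandardData.exists_swap` — the data `(−√−1 := (√−1)⁻¹, τ ↔ τ⁻¹)` are again standard data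
  (Def. 1.9 is symmetric in `τ^{±1}`), with the SAME standard sets of values
  (`isStandardSetOfValues_iff_of_swap`); hence `Thm110ii H S S⁻` at identity transport
  (`thm110ii_of_transport_eq_self_of_swap`) and the same-datum closure reduces to the `τ`-clause
  (`forall_thm110ii_iff_of_transport_eq_self`);
* **`not_forall_thm110ii_of_exists`** — the REFUTATION SHAPE of the ∀-closure of F-0514: ONE
  `MuTwoSetting` with a `Compat` datum, an admissible `ε_Z`, an étale theta datum and TWO standard data
  whose `τ`-value sets satisfy `V(τα) ∉ {V(τβ), V(τβ⁻¹)}` kills it (through the identity witness of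
  `Thm110Hypothesis`); conversely the closure forces all standard data over one datum to share their
  `τ`-value sets (`forall_thm110ii_imp_valuesAt_tau`).
So at any future model the ∀-closure of F-0514 is decided by listing the value sets `V(y)` of `η̈^{Θ,Z}` at
the candidate points `y` with `Ü(y)² = −1`. HONEST FRAMING: statements about OUR typed schema; print pins
the values by Prop. 1.4 (ii)(iii) (`Θ̈(τ^{±1})`), the typed interface does not; characterising or refuting
a typed schema says nothing about [EtTh] Thm. 1.10, which concerns actual curves with their actual
evaluation maps; typed ≠ proved; no side is taken on [IUTchIII] Cor. 3.12 or on any author.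
-/

noncomputable section

namespace Literature.AnabelianGeometry.EtaleTheta

open Literature.AnabelianGeometry.SemiGraphs

variable {p : ℕ} [Fact p.Prime]

/-! ### (A) General `γ`: `Thm110ii` at THE induced `δ` -/

section General

variable {Mα Mβ : MuTwoSetting p} {εα : Mα.GtpC} {εβ : Mβ.GtpC} {hCα : Mα.toThetaSetting.Compat}
  {hCβ : Mβ.toThetaSetting.Compat} {Eα : Mα.toThetaSetting.EtaleThetaData}
  {Eβ : Mβ.toThetaSetting.EtaleThetaData} {γ : Mα.dotC εα ≃ₜ* Mβ.dotC εβ}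

/-- **Thm. 1.10 (ii) at THE induced isomorphism**: since «the isomorphism `K^×_α →̃ K^×_β` induced by `γ`»
is unique (`Thm110DeltaInduced.unique`), the typed `Thm110ii H Sα Sβ` (an `∃ δ`) is EQUIVALENT to the
forward value-set clause `Thm110ValuesForward H Sα Sβ δ₀` at any one induced `δ₀`.
[cite: MochizukiEtTh2009, Thm 1.10 (ii) p.30] -/
theorem thm110ii_iff_valuesForward (H : Thm110Hypothesis εα εβ hCα hCβ Eα Eβ γ)
    (Sα : Mα.StandardData Eα.toKummerData) (Sβ : Mβ.StandardData Eβ.toKummerData)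
    {δ₀ : (↥Mα.Kdd)ˣ ≃* (↥Mβ.Kdd)ˣ} (hδ₀ : Thm110DeltaInduced H δ₀) :
    Thm110ii H Sα Sβ ↔ Thm110ValuesForward H Sα Sβ δ₀ := by
  constructor
  · rintro ⟨δ, hδ, hV⟩
    have hδ' : Thm110DeltaInduced H δ := hδ
    obtain rfl : δ = δ₀ := hδ'.unique hδ₀
    exact ⟨hδ', hV⟩
  · exact thm110ii_of_valuesForward

/-- **Thm. 1.10 (ii) unfolded over the two standard sets of values** (Def. 1.9 (i): the standard sets of
values are `η̈^{Θ,Z}|_τ` and `η̈^{Θ,Z}|_{τ⁻¹}`): at an induced `δ₀`, `Thm110ii H Sα Sβ` says exactly that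
`δ₀` carries EACH of `V(τα)`, `V(τα⁻¹)` onto one of `V(τβ)`, `V(τβ⁻¹)`.
[cite: MochizukiEtTh2009, Thm 1.10 (ii) p.30] -/
theorem thm110ii_iff_image_valuesAt (H : Thm110Hypothesis εα εβ hCα hCβ Eα Eβ γ)
    (Sα : Mα.StandardData Eα.toKummerData) (Sβ : Mβ.StandardData Eβ.toKummerData)
    {δ₀ : (↥Mα.Kdd)ˣ ≃* (↥Mβ.Kdd)ˣ} (hδ₀ : Thm110DeltaInduced H δ₀) :
    Thm110ii H Sα Sβ ↔
      (δ₀ '' Mα.valuesAt hCα εα Eα.etaDd Sα.tau = Mβ.valuesAt hCβ εβ Eβ.etaDd Sβ.tau ∨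
          δ₀ '' Mα.valuesAt hCα εα Eα.etaDd Sα.tau = Mβ.valuesAt hCβ εβ Eβ.etaDd Sβ.tauInv) ∧
        (δ₀ '' Mα.valuesAt hCα εα Eα.etaDd Sα.tauInv = Mβ.valuesAt hCβ εβ Eβ.etaDd Sβ.tau ∨
          δ₀ '' Mα.valuesAt hCα εα Eα.etaDd Sα.tauInv = Mβ.valuesAt hCβ εβ Eβ.etaDd Sβ.tauInv) := by
  rw [thm110ii_iff_valuesForward H Sα Sβ hδ₀]
  unfold Thm110ValuesForward MuTwoSetting.IsStandardSetOfValues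
  constructor
  · rintro ⟨-, h⟩
    exact ⟨h _ (Or.inl rfl), h _ (Or.inr rfl)⟩
  · rintro ⟨h₁, h₂⟩
    refine ⟨hδ₀, ?_⟩
    rintro V (rfl | rfl)
    exacts [h₁, h₂]

/-- **F-0514 — the refutation shape for a general `γ`**: if THE induced `δ₀` carries `V(τα)` onto neither
`V(τβ)` nor `V(τβ⁻¹)`, then `Thm110ii H Sα Sβ` FAILS (a statement about the free `evalAt` of the points;
print pins the values by Prop. 1.4 (ii)(iii)). [cite: MochizukiEtTh2009, Thm 1.10 (ii) p.30] -/
theorem not_thm110ii_of_deltaInduced (H : Thm110Hypothesis εα εβ hCα hCβ Eα Eβ γ)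
    (Sα : Mα.StandardData Eα.toKummerData) (Sβ : Mβ.StandardData Eβ.toKummerData)
    {δ₀ : (↥Mα.Kdd)ˣ ≃* (↥Mβ.Kdd)ˣ} (hδ₀ : Thm110DeltaInduced H δ₀)
    (h₁ : δ₀ '' Mα.valuesAt hCα εα Eα.etaDd Sα.tau ≠ Mβ.valuesAt hCβ εβ Eβ.etaDd Sβ.tau)
    (h₂ : δ₀ '' Mα.valuesAt hCα εα Eα.etaDd Sα.tau ≠ Mβ.valuesAt hCβ εβ Eβ.etaDd Sβ.tauInv) :
    ¬ Thm110ii H Sα Sβ := fun h =>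
  ((thm110ii_iff_image_valuesAt H Sα Sβ hδ₀).mp h).1.elim h₁ h₂

end General

/-! ### (B) One setting, one étale theta datum, identity cohomology transport -/

section SameSetting

variable {M : MuTwoSetting p} {εZ : M.GtpC} {hC : M.toThetaSetting.Compat}
  {E : M.toThetaSetting.EtaleThetaData} {γ : M.dotC εZ ≃ₜ* M.dotC εZ}

/-- At identity cohomology transport the identity of `K̈^×` IS induced by `γ` (first clause of Thm. 1.10
(ii)); by uniqueness it is THE induced isomorphism. [cite: MochizukiEtTh2009, Thm 1.10 (ii) p.30] -/
theorem thm110DeltaInduced_refl_of_transport_eq_self (H : Thm110Hypothesis εZ εZ hC hC E E γ)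
    (hT : ∀ x, ThetaSetting.transport H.companion H.thm16i x = x) :
    Thm110DeltaInduced H (MulEquiv.refl _) := fun a => by
  rw [hT]
  rfl

/-- Every hypothesis structure with `γ_X = id` has identity cohomology transport (companions of the
identity are trivial, `ThetaSetting.transport_refl`). [cite: MochizukiEtTh2009, Thm 1.6 (iii) p.24] -/
theorem transport_eq_self_of_γX_eq_refl (H : Thm110Hypothesis εZ εZ hC hC E E γ)
    (hγX : H.γX = ContinuousMulEquiv.refl M.PiTemp) (x : M.toThetaSetting.H1 M.toThetaSetting.GtpYdd) :
    ThetaSetting.transport H.companion H.thm16i x = x := by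
  have key : ∀ {γX : M.PiTemp ≃ₜ* M.PiTemp} (_ : γX = ContinuousMulEquiv.refl M.PiTemp)
      (c : ThetaSetting.ThetaCompanion γX) (h : ThetaSetting.Thm16i γX) (x),
      ThetaSetting.transport c h x = x := by
    intro γX hγ c h x
    subst hγ
    exact ThetaSetting.transport_refl c h x
  exact key hγX H.companion H.thm16i x

/-- **F-0514 over one setting — the exact criterion**: for a hypothesis structure over the identity data
with identity cohomology transport, `Thm110ii H Sα Sβ` holds iff EVERY STANDARD SET OF VALUES of
`η̈^{Θ,Z}` for the standard data `Sα` is a standard set of values for `Sβ` («preserves the standard sets of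
values», p. 30, read at `δ = id`). [cite: MochizukiEtTh2009, Thm 1.10 (ii) p.30] -/
theorem thm110ii_iff_isStandardSetOfValues_of_transport_eq_self (H : Thm110Hypothesis εZ εZ hC hC E E γ)
    (hT : ∀ x, ThetaSetting.transport H.companion H.thm16i x = x)
    (Sα Sβ : M.StandardData E.toKummerData) :
    Thm110ii H Sα Sβ ↔
      ∀ V, M.IsStandardSetOfValues hC εZ Sα E.etaDd V → M.IsStandardSetOfValues hC εZ Sβ E.etaDd V := by
  rw [thm110ii_iff_valuesForward H Sα Sβ (thm110DeltaInduced_refl_of_transport_eq_self H hT)]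
  unfold Thm110ValuesForward
  simp only [MulEquiv.coe_refl, Set.image_id]
  exact and_iff_right (thm110DeltaInduced_refl_of_transport_eq_self H hT)

/-- **F-0514 over one setting, unfolded**: at identity transport, `Thm110ii H Sα Sβ` says exactly
`V(τα) ∈ {V(τβ), V(τβ⁻¹)}` and `V(τα⁻¹) ∈ {V(τβ), V(τβ⁻¹)}` for the value sets `V(y)` of `η̈^{Θ,Z}` at
the points of the two standard data (Def. 1.9 (i)). [cite: MochizukiEtTh2009, Thm 1.10 (ii) p.30] -/
theorem thm110ii_iff_valuesAt_of_transport_eq_self (H : Thm110Hypothesis εZ εZ hC hC E E γ)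
    (hT : ∀ x, ThetaSetting.transport H.companion H.thm16i x = x)
    (Sα Sβ : M.StandardData E.toKummerData) :
    Thm110ii H Sα Sβ ↔
      (M.valuesAt hC εZ E.etaDd Sα.tau = M.valuesAt hC εZ E.etaDd Sβ.tau ∨
          M.valuesAt hC εZ E.etaDd Sα.tau = M.valuesAt hC εZ E.etaDd Sβ.tauInv) ∧
        (M.valuesAt hC εZ E.etaDd Sα.tauInv = M.valuesAt hC εZ E.etaDd Sβ.tau ∨
          M.valuesAt hC εZ E.etaDd Sα.tauInv = M.valuesAt hC εZ E.etaDd Sβ.tauInv) := by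
  rw [thm110ii_iff_isStandardSetOfValues_of_transport_eq_self H hT]
  unfold MuTwoSetting.IsStandardSetOfValues
  constructor
  · intro h
    exact ⟨h _ (Or.inl rfl), h _ (Or.inr rfl)⟩
  · rintro ⟨h₁, h₂⟩ V (rfl | rfl)
    exacts [h₁, h₂]

/-- The same criterion for hypothesis structures with `γ_X = id`. [cite: MochizukiEtTh2009, Thm 1.10 (ii) p.30] -/
theorem thm110ii_iff_valuesAt_of_γX_eq_refl (H : Thm110Hypothesis εZ εZ hC hC E E γ)
    (hγX : H.γX = ContinuousMulEquiv.refl M.PiTemp) (Sα Sβ : M.StandardData E.toKummerData) :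
    Thm110ii H Sα Sβ ↔
      (M.valuesAt hC εZ E.etaDd Sα.tau = M.valuesAt hC εZ E.etaDd Sβ.tau ∨
          M.valuesAt hC εZ E.etaDd Sα.tau = M.valuesAt hC εZ E.etaDd Sβ.tauInv) ∧
        (M.valuesAt hC εZ E.etaDd Sα.tauInv = M.valuesAt hC εZ E.etaDd Sβ.tau ∨
          M.valuesAt hC εZ E.etaDd Sα.tauInv = M.valuesAt hC εZ E.etaDd Sβ.tauInv) :=
  thm110ii_iff_valuesAt_of_transport_eq_self H (transport_eq_self_of_γX_eq_refl H hγX) Sα Sβ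

/-- **F-0514 — the refutation shape over one setting**: at identity transport, if the value set of
`η̈^{Θ,Z}` at `τα` is neither the value set at `τβ` nor the one at `τβ⁻¹`, then `Thm110ii H Sα Sβ` FAILS
(print forces `V(τ^{±1}) = ±O^×·Θ̈(±√−1)`-type value sets by Prop. 1.4 (ii)(iii); the typed interface leaves
`evalAt` free). [cite: MochizukiEtTh2009, Thm 1.10 (ii) p.30] -/
theorem not_thm110ii_of_transport_eq_self (H : Thm110Hypothesis εZ εZ hC hC E E γ)
    (hT : ∀ x, ThetaSetting.transport H.companion H.thm16i x = x)
    (Sα Sβ : M.StandardData E.toKummerData)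
    (h₁ : M.valuesAt hC εZ E.etaDd Sα.tau ≠ M.valuesAt hC εZ E.etaDd Sβ.tau)
    (h₂ : M.valuesAt hC εZ E.etaDd Sα.tau ≠ M.valuesAt hC εZ E.etaDd Sβ.tauInv) :
    ¬ Thm110ii H Sα Sβ := fun h =>
  ((thm110ii_iff_valuesAt_of_transport_eq_self H hT Sα Sβ).mp h).1.elim h₁ h₂

/-- The refutation shape for hypothesis structures with `γ_X = id`. [cite: MochizukiEtTh2009, Thm 1.10 (ii) p.30] -/
theorem not_thm110ii_of_γX_eq_refl (H : Thm110Hypothesis εZ εZ hC hC E E γ)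
    (hγX : H.γX = ContinuousMulEquiv.refl M.PiTemp) (Sα Sβ : M.StandardData E.toKummerData)
    (h₁ : M.valuesAt hC εZ E.etaDd Sα.tau ≠ M.valuesAt hC εZ E.etaDd Sβ.tau)
    (h₂ : M.valuesAt hC εZ E.etaDd Sα.tau ≠ M.valuesAt hC εZ E.etaDd Sβ.tauInv) :
    ¬ Thm110ii H Sα Sβ :=
  not_thm110ii_of_transport_eq_self H (transport_eq_self_of_γX_eq_refl H hγX) Sα Sβ h₁ h₂

/-! ### (C) The swap `τ ↔ τ⁻¹` of standard data -/

/-- **Def. 1.9 is symmetric in `τ^{±1}`**: replacing `√−1` by `−√−1 = (√−1)⁻¹` (again a square root of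
`−1` in `K`) swaps "the 4-torsion point `τ` determined by `√−1`" and "`τ⁻¹` determined by `−√−1`"
(p. 29); the swapped tuple is again standard data. [cite: MochizukiEtTh2009, Def 1.9 p.29] -/
theorem MuTwoSetting.StandardData.exists_swap {E₀ : M.toThetaSetting.KummerData}
    (S : M.StandardData E₀) :
    ∃ S' : M.StandardData E₀, S'.tau = S.tauInv ∧ S'.tauInv = S.tau :=
  ⟨{ sqrtNegOne := S.sqrtNegOne⁻¹
     sqrtNegOne_mem := inv_mem S.sqrtNegOne_mem
     sqrtNegOne_sq := by rw [inv_pow, S.sqrtNegOne_sq, inv_neg, inv_one]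
     tau := S.tauInv
     tauInv := S.tau
     tau_coord := S.tauInv_coord
     tauInv_coord := by rw [inv_inv]; exact S.tau_coord }, rfl, rfl⟩

/-- Swapped standard data have the SAME standard sets of values («either of the following two sets of
values … `η̈^{Θ,Z}|_τ, η̈^{Θ,Z}|_{τ⁻¹}`», Def. 1.9 (i)). [cite: MochizukiEtTh2009, Def 1.9 (i) p.29] -/
theorem MuTwoSetting.isStandardSetOfValues_iff_of_swap {E₀ : M.toThetaSetting.KummerData}
    (hC : M.toThetaSetting.Compat) (εZ : M.GtpC) {S S' : M.StandardData E₀} (hτ : S'.tau = S.tauInv)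
    (hτ' : S'.tauInv = S.tau) (x : M.toThetaSetting.H1 M.toThetaSetting.GtpYdd) (V : Set (↥M.Kdd)ˣ) :
    M.IsStandardSetOfValues hC εZ S' x V ↔ M.IsStandardSetOfValues hC εZ S x V := by
  unfold MuTwoSetting.IsStandardSetOfValues
  rw [hτ, hτ', or_comm]

/-- **Thm. 1.10 (ii) for swapped standard data** at identity transport: `Thm110ii H S S⁻` holds (with
`δ = id`), the standard sets of values of `S` and `S⁻` being the same two sets.
[cite: MochizukiEtTh2009, Thm 1.10 (ii) p.30] -/
theorem thm110ii_of_transport_eq_self_of_swap (H : Thm110Hypothesis εZ εZ hC hC E E γ)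
    (hT : ∀ x, ThetaSetting.transport H.companion H.thm16i x = x)
    {S S' : M.StandardData E.toKummerData} (hτ : S'.tau = S.tauInv) (hτ' : S'.tauInv = S.tau) :
    Thm110ii H S S' :=
  (thm110ii_iff_isStandardSetOfValues_of_transport_eq_self H hT S S').mpr fun V hV =>
    (MuTwoSetting.isStandardSetOfValues_iff_of_swap hC εZ hτ hτ' E.etaDd V).mpr hV

/-- **The same-datum closure reduces to the `τ`-clause**: at identity transport, `Thm110ii H Sα Sβ` for
ALL pairs of standard data over `E` iff for all pairs the value set at `τα` is the value set at `τβ` or at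
`τβ⁻¹` — the `τ⁻¹`-clause follows by applying the `τ`-clause to the swapped data `Sα⁻`.
[cite: MochizukiEtTh2009, Thm 1.10 (ii) p.30] -/
theorem forall_thm110ii_iff_of_transport_eq_self (H : Thm110Hypothesis εZ εZ hC hC E E γ)
    (hT : ∀ x, ThetaSetting.transport H.companion H.thm16i x = x) :
    (∀ Sα Sβ : M.StandardData E.toKummerData, Thm110ii H Sα Sβ) ↔
      ∀ Sα Sβ : M.StandardData E.toKummerData,
        M.valuesAt hC εZ E.etaDd Sα.tau = M.valuesAt hC εZ E.etaDd Sβ.tau ∨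
          M.valuesAt hC εZ E.etaDd Sα.tau = M.valuesAt hC εZ E.etaDd Sβ.tauInv := by
  constructor
  · intro h Sα Sβ
    exact ((thm110ii_iff_valuesAt_of_transport_eq_self H hT Sα Sβ).mp (h Sα Sβ)).1
  · intro h Sα Sβ
    refine (thm110ii_iff_valuesAt_of_transport_eq_self H hT Sα Sβ).mpr ⟨h Sα Sβ, ?_⟩
    obtain ⟨S', hτ, -⟩ := MuTwoSetting.StandardData.exists_swap Sα
    rw [← hτ]
    exact h S' Sβ

end SameSetting

/-! ### (D) The universal closure of F-0514: refutation shape and necessary condition -/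

section Closure

/-- **The ∀-closure of F-0514 forces, over every setting and étale theta datum, ALL standard data to share
their `τ`-value sets** (through the identity witness of `Thm110Hypothesis`, `exists_thm110Hypothesis_γX_eq_refl`):
a condition on the free evaluation maps of the points `y` with `Ü(y)² = −1`, not a consequence of the
interface. [cite: MochizukiEtTh2009, Thm 1.10 (ii) p.30] -/
theorem forall_thm110ii_imp_valuesAt_tau
    (h : ∀ (Mα Mβ : MuTwoSetting p) (εα : Mα.GtpC) (εβ : Mβ.GtpC) (hCα : Mα.toThetaSetting.Compat)
      (hCβ : Mβ.toThetaSetting.Compat) (Eα : Mα.toThetaSetting.EtaleThetaData)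
      (Eβ : Mβ.toThetaSetting.EtaleThetaData) (γ : Mα.dotC εα ≃ₜ* Mβ.dotC εβ)
      (H : Thm110Hypothesis εα εβ hCα hCβ Eα Eβ γ) (Sα : Mα.StandardData Eα.toKummerData)
      (Sβ : Mβ.StandardData Eβ.toKummerData), Thm110ii H Sα Sβ)
    (M : MuTwoSetting p) {εZ : M.GtpC} (hZ : M.IsAdmissibleEpsZ εZ) (hC : M.toThetaSetting.Compat)
    (E : M.toThetaSetting.EtaleThetaData) (Sα Sβ : M.StandardData E.toKummerData) :
    M.valuesAt hC εZ E.etaDd Sα.tau = M.valuesAt hC εZ E.etaDd Sβ.tau ∨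
      M.valuesAt hC εZ E.etaDd Sα.tau = M.valuesAt hC εZ E.etaDd Sβ.tauInv := by
  obtain ⟨H, hH⟩ := exists_thm110Hypothesis_γX_eq_refl hZ hC E
  exact ((thm110ii_iff_valuesAt_of_γX_eq_refl H hH Sα Sβ).mp (h _ _ _ _ _ _ _ _ _ H Sα Sβ)).1

/-- **R5 — the REFUTATION SHAPE of the universal closure of the schema `Thm110ii` (F-0514)**: ONE
`MuTwoSetting` with a `Compat` datum, an admissible `ε_Z`, an étale theta datum `E` and TWO standard data
`Sα`, `Sβ` over `E` with `V(τα) ∉ {V(τβ), V(τβ⁻¹)}` refutes `∀ (settings) (H) (Sα) (Sβ), Thm110ii H Sα Sβ`.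
No such witness is exhibited here: every instance needs an étale theta datum and Def-1.9 points, which have
no producer at the tree's models yet (a Kummer-carrying `MuTwoSetting` is the R78 cluster's construction);
the row stays consumable AT NAMED INSTANCES. [cite: MochizukiEtTh2009, Thm 1.10 (ii) p.30] -/
theorem not_forall_thm110ii_of_exists
    (hex : ∃ (M : MuTwoSetting p) (εZ : M.GtpC) (_ : M.IsAdmissibleEpsZ εZ)
      (hC : M.toThetaSetting.Compat) (E : M.toThetaSetting.EtaleThetaData)
      (Sα Sβ : M.StandardData E.toKummerData),
      M.valuesAt hC εZ E.etaDd Sα.tau ≠ M.valuesAt hC εZ E.etaDd Sβ.tau ∧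
        M.valuesAt hC εZ E.etaDd Sα.tau ≠ M.valuesAt hC εZ E.etaDd Sβ.tauInv) :
    ¬ ∀ (Mα Mβ : MuTwoSetting p) (εα : Mα.GtpC) (εβ : Mβ.GtpC) (hCα : Mα.toThetaSetting.Compat)
        (hCβ : Mβ.toThetaSetting.Compat) (Eα : Mα.toThetaSetting.EtaleThetaData)
        (Eβ : Mβ.toThetaSetting.EtaleThetaData) (γ : Mα.dotC εα ≃ₜ* Mβ.dotC εβ)
        (H : Thm110Hypothesis εα εβ hCα hCβ Eα Eβ γ) (Sα : Mα.StandardData Eα.toKummerData)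
        (Sβ : Mβ.StandardData Eβ.toKummerData), Thm110ii H Sα Sβ := by
  intro h
  obtain ⟨M, εZ, hZ, hC, E, Sα, Sβ, h₁, h₂⟩ := hex
  exact (forall_thm110ii_imp_valuesAt_tau h M hZ hC E Sα Sβ).elim h₁ h₂

end Closure

end Literature.AnabelianGeometry.EtaleTheta

end
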